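import Mathlib

/-!
# `WeightedInvariant.LocalWeightedDrop`: the embedding `k⟦σ⟧ → k⟦σ, s, y⟧` and an `m`-th root of `1 + dσ`

Route `ResolutionOfSingularities/WeightedInvariant`, crux `LocalWeightedDrop`
(stmt-ResolutionOfSingularities-8899).  [OURS · L1 W4.3] — elementary tools for §1 B2 («wild successors are
twisted cylinders») of ideator res-L1-w43-idea-1's `Sketch-L1-idea-1.lean` v3 (sha16 `631198685223c190`),
proved in the companion file `…TwistedCylinder`.  Nothing here is a statement of the manuscript under review
on ladder RESOLUTION; AI-produced, weaker than expert review.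

* `GradedGame.exists_pow_eq_one_add_C_mul_X` — for `m` invertible in the field `k`, `1 + dσ` has an `m`-th
  root `λ₁ ∈ k⟦σ⟧` with `λ₁(0) = 1` (Hensel's lemma in the `σ`-adically complete ring `k⟦σ⟧`:
  Mathlib's `IsAdicComplete.henselianRing`, simple root `1` of `T^m − (1 + dσ)` modulo `σ`).
* `GradedGame.embσ` — the embedding `k⟦σ⟧ → k⟦X₀, …, X_N⟧` along `σ = X 0` (`PowerSeries.subst`), with its
  ring-morphism bookkeeping, invariance under substitutions fixing `X 0` (`subst_embσ`), and the linear-part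
  computation `coeff_single_succ_embσ_mul_X`: the `X_{j+1}`-linear coefficient of `embσ q · X_{v+1}` is
  `q(0)·[j = v]`.
-/

set_option linter.dupNamespace false -- mandated namespace of this single-conjunct summit
set_option autoImplicit false

namespace Summit.ResolutionOfSingularities.ResolutionOfSingularities.Theorems

namespace GradedGame

open MvPowerSeries

variable {k : Type} [Field k]

/-! ## An `m`-th root of `1 + dσ` in `k⟦σ⟧` (Hensel) -/

/-- For `m` invertible in `k`, `1 + d σ` has an `m`-th root `λ₁ ∈ k⟦σ⟧` with `λ₁(0) = 1` (Hensel's lemma in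
the `σ`-adically complete ring `k⟦σ⟧`, simple root `1` of `T^m − (1 + dσ)` modulo `σ`). [OURS · L1 W4.3] -/
theorem exists_pow_eq_one_add_C_mul_X (m : ℕ) (hm : (m : k) ≠ 0) (d : k) :
    ∃ lam : PowerSeries k, lam ^ m = 1 + PowerSeries.C d * PowerSeries.X ∧ PowerSeries.constantCoeff lam = 1 := by
  have hm0 : m ≠ 0 := by rintro rfl; exact hm (by simp)
  set u : PowerSeries k := 1 + PowerSeries.C d * PowerSeries.X with hu
  have hmonic : (Polynomial.X ^ m - Polynomial.C u : Polynomial (PowerSeries k)).Monic :=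
    Polynomial.monic_X_pow_sub_C u hm0
  have heval : (Polynomial.X ^ m - Polynomial.C u : Polynomial (PowerSeries k)).eval 1 ∈
      Ideal.span {(PowerSeries.X : PowerSeries k)} := by
    rw [Polynomial.eval_sub, Polynomial.eval_pow, Polynomial.eval_X, Polynomial.eval_C, one_pow, hu,
      Ideal.mem_span_singleton]
    exact ⟨-PowerSeries.C d, by ring⟩
  have hder : IsUnit (Ideal.Quotient.mk (Ideal.span {(PowerSeries.X : PowerSeries k)})
      ((Polynomial.derivative (Polynomial.X ^ m - Polynomial.C u : Polynomial (PowerSeries k))).eval 1)) := by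
    rw [Polynomial.derivative_sub, Polynomial.derivative_X_pow, Polynomial.derivative_C, sub_zero,
      Polynomial.eval_mul, Polynomial.eval_C, Polynomial.eval_pow, Polynomial.eval_X, one_pow, mul_one]
    refine IsUnit.map _ ?_
    rw [← map_natCast PowerSeries.C m]
    exact (isUnit_iff_ne_zero.mpr hm).map _
  obtain ⟨lam, hroot, hlam⟩ :=
    HenselianRing.is_henselian (R := PowerSeries k) (I := Ideal.span {(PowerSeries.X : PowerSeries k)})
      _ hmonic 1 heval hder
  refine ⟨lam, ?_, ?_⟩
  · have := hroot
    rw [Polynomial.IsRoot, Polynomial.eval_sub, Polynomial.eval_pow, Polynomial.eval_X, Polynomial.eval_C,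
      sub_eq_zero] at this
    exact this
  · rw [Ideal.mem_span_singleton] at hlam
    obtain ⟨q, hq⟩ := hlam
    have h1 := congrArg PowerSeries.constantCoeff hq
    rw [map_sub, map_one, map_mul, PowerSeries.constantCoeff_X, zero_mul, sub_eq_zero] at h1
    exact h1

/-! ## The embedding `k⟦σ⟧ → k⟦σ, s, y⟧` along `σ = X 0` -/

section Emb

variable {N : ℕ}

/-- Embedding of a one-variable series along the first variable `X 0`. [OURS · L1 W4.3] -/
noncomputable def embσ (q : PowerSeries k) : MvPowerSeries (Fin (N + 1)) k :=
  PowerSeries.subst (X (0 : Fin (N + 1)) : MvPowerSeries (Fin (N + 1)) k) q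

/-- `X 0` is substitutable into a one-variable series. [OURS · L1 W4.3] -/
theorem hasSubst_σ : PowerSeries.HasSubst (X (0 : Fin (N + 1)) : MvPowerSeries (Fin (N + 1)) k) :=
  PowerSeries.HasSubst.of_constantCoeff_zero (by simp [constantCoeff_X])

/-- `embσ` is multiplicative. [OURS · L1 W4.3] -/
theorem embσ_mul (q r : PowerSeries k) : (embσ (q * r) : MvPowerSeries (Fin (N + 1)) k) = embσ q * embσ r :=
  PowerSeries.subst_mul hasSubst_σ q r

/-- `embσ` commutes with powers. [OURS · L1 W4.3] -/
theorem embσ_pow (q : PowerSeries k) (m : ℕ) : (embσ (q ^ m) : MvPowerSeries (Fin (N + 1)) k) = embσ q ^ m :=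
  PowerSeries.subst_pow hasSubst_σ q m

/-- `embσ 1 = 1`. [OURS · L1 W4.3] -/
theorem embσ_one : (embσ (1 : PowerSeries k) : MvPowerSeries (Fin (N + 1)) k) = 1 := by
  rw [show (1 : PowerSeries k) = PowerSeries.C 1 from (map_one _).symm]
  unfold embσ
  rw [PowerSeries.subst_C, map_one]

/-- `embσ σ = X 0`. [OURS · L1 W4.3] -/
theorem embσ_X : (embσ (PowerSeries.X : PowerSeries k) : MvPowerSeries (Fin (N + 1)) k) = X 0 :=
  PowerSeries.subst_X hasSubst_σ

/-- `embσ (C r) = C r`. [OURS · L1 W4.3] -/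
theorem embσ_C (r : k) : (embσ (PowerSeries.C r) : MvPowerSeries (Fin (N + 1)) k) = C r :=
  PowerSeries.subst_C r

/-- `embσ` is additive. [OURS · L1 W4.3] -/
theorem embσ_add (q r : PowerSeries k) : (embσ (q + r) : MvPowerSeries (Fin (N + 1)) k) = embσ q + embσ r :=
  PowerSeries.subst_add hasSubst_σ q r

/-- Splitting off the constant term: `embσ q = X 0 · embσ q' + C (q 0)`. [OURS · L1 W4.3] -/
theorem embσ_eq_X_mul_add_C (q : PowerSeries k) :
    ∃ q' : PowerSeries k, (embσ q : MvPowerSeries (Fin (N + 1)) k) = X 0 * embσ q' + C (PowerSeries.constantCoeff q) := by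
  refine ⟨PowerSeries.mk fun i => PowerSeries.coeff (i + 1) q, ?_⟩
  conv_lhs => rw [PowerSeries.eq_X_mul_shift_add_const q]
  rw [embσ_add, embσ_mul, embσ_X, embσ_C]

/-- A substitution fixing `X 0` fixes every embedded series. [OURS · L1 W4.3] -/
theorem subst_embσ {τ : Type} {G : Fin (N + 1) → MvPowerSeries τ k} (hG : HasSubst G) (q : PowerSeries k) :
    subst G (embσ q : MvPowerSeries (Fin (N + 1)) k) = PowerSeries.subst (G 0) q := by
  unfold embσ
  rw [PowerSeries.subst_def, PowerSeries.subst_def, subst_comp_subst_apply hasSubst_σ.const hG, subst_X hG]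

/-- The constant coefficient of an embedded series. [OURS · L1 W4.3] -/
theorem constantCoeff_embσ (q : PowerSeries k) :
    constantCoeff (embσ q : MvPowerSeries (Fin (N + 1)) k) = PowerSeries.constantCoeff q := by
  obtain ⟨q', hq'⟩ := embσ_eq_X_mul_add_C (N := N) q
  rw [hq', map_add, map_mul, constantCoeff_X, zero_mul, zero_add, constantCoeff_C]

/-- The `X_{j+1}`-linear coefficient of `embσ q · X_{v+1}` is `q(0) · [j = v]` (everything else is divisible by
`X 0`). [OURS · L1 W4.3] -/
theorem coeff_single_succ_embσ_mul_X (q : PowerSeries k) (v j : Fin N) :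
    coeff (Finsupp.single j.succ 1) ((embσ q : MvPowerSeries (Fin (N + 1)) k) * X v.succ) =
      if j = v then PowerSeries.constantCoeff q else 0 := by
  classical
  obtain ⟨q', hq'⟩ := embσ_eq_X_mul_add_C (N := N) q
  rw [hq', add_mul, map_add, mul_assoc]
  have h0 : coeff (Finsupp.single j.succ 1) (X (0 : Fin (N + 1)) * ((embσ q' : MvPowerSeries (Fin (N + 1)) k) * X v.succ)) = 0 :=
    (X_dvd_iff.mp (dvd_mul_right _ _)) _ (by simp [Fin.succ_ne_zero])
  rw [h0, zero_add, coeff_C_mul, coeff_X]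
  by_cases h : j = v
  · subst h; simp
  · rw [if_neg, if_neg h, mul_zero]
    intro h'
    exact h (Fin.succ_injective _ ((Finsupp.single_left_inj one_ne_zero).mp h'))

end Emb

end GradedGame

end Summit.ResolutionOfSingularities.ResolutionOfSingularities.Theorems
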